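import Summits.Langlands.Langlands.Theorems.CensusDeficit1951.Negative.CensusDeficit1951FalseOfEvenIcosahedralMaassFormAt1951

/-!
# Route `QuarterDeficit1951` (Langlands) — crux `WindowFormDictionary` (stmt-Langlands-17934): CLOSING FILE

The route's inlined weight-0 Maass cusp form predicate for `(Γ₀(1951), χ)` — `C²`, `Δu + λu = 0`,
`u(γz) = χ(d_γ) u(z)` for `γ ∈ Γ₀(1951)`, vanishing period-1 mean at the cusp `∞`, vanishing period-1951
mean at the cusp `0` (after `S`), bounded — implies the census predicate
`Literature.NumberTheory.Automorphic.IsMaassCuspFormOn 1951 χ u λ`, whose only extra content is the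
period-1951 cuspidality at `g · ∞` for EVERY `g ∈ SL₂(ℤ)`.

The mathematics (two cusps at the prime level 1951: `1951 ∣ c(g)` gives `g ∈ Γ₀(1951)` and
`∫₀¹⁹⁵¹ = 1951 • ∫₀¹ = 0`; otherwise `g = γ S Tᵏ`, `k ≡ d c⁻¹ (mod 1951)`, `γ = g T⁻ᵏ S⁻¹ ∈ Γ₀(1951)` of
`d`-entry `c`, and `x ↦ u(S(x+iy))` is 1951-periodic because `S T¹⁹⁵¹ S⁻¹ = (1 0; −1951 1) ∈ Γ₀(1951)`)
is the LANDED theorem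
`Summit.Langlands.Langlands.Theorems.CensusDeficit1951.Negative.isMaassCuspFormOn_of_two_cusps`
(p158485), which carries exactly the binders of the route decl; this file specialises it to close the
item BY NAME.
-/

-- `Summit.<Summit>.<Problem>`: for the single-conjunct summit `Langlands` the duplicate is mandated.
set_option linter.dupNamespace false

namespace Summit.Langlands.Langlands.Theorems.QuarterDeficit1951

/-- **Crux `WindowFormDictionary` (stmt-Langlands-17934), by name.** The route's inlined Maass-form
predicate (C², eigenfunction of the hyperbolic Laplacian, weight-0 `χ`-automorphy on `Γ₀(1951)`,
vanishing constant terms at `∞` (period 1) and at `0` (period 1951 after `S`), bounded) implies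
`IsMaassCuspFormOn 1951 χ u λ` — cuspidality at every cusp `g · ∞`, `g ∈ SL₂(ℤ)`, from the two inlined
cusp clauses, the level 1951 being prime (two `Γ₀(1951)`-inequivalent cusps). A direct specialisation
of `CensusDeficit1951.Negative.isMaassCuspFormOn_of_two_cusps`. [cite: Iwaniec2002, §2.2–§3.1] -/
theorem WindowFormDictionary_proof :
    Summit.Langlands.Langlands.Theses.QuarterDeficit1951.WindowFormDictionary := by
  unfold Summit.Langlands.Langlands.Theses.QuarterDeficit1951.WindowFormDictionary
  intro χ u lam hC2 heig hsl hinf hzero hbd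
  exact Summit.Langlands.Langlands.Theorems.CensusDeficit1951.Negative.isMaassCuspFormOn_of_two_cusps
    χ u lam hC2 heig hsl hinf hzero hbd

end Summit.Langlands.Langlands.Theorems.QuarterDeficit1951
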